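import Literature.Geometry.Kaehler.ComplexTorusIntegralHodgeClassesIsogeny
import Literature.Geometry.Kaehler.ComplexTorusTranscendentalLatticeAllDegrees
import Literature.Geometry.Kaehler.ComplexTorusIsogenyPullbackVolume
import Literature.Geometry.Kaehler.ComplexTorusCycleClassPairing
import HarnessLib

/-!
# The transcendental lattice in every degree under ISOGENIES: `⟨f^*x, f^*y⟩ = det ρ_r(f) · ⟨x, y⟩` in every bidegree `(k, l)`,
# `f^* T′ ⊆ T`, `e(f)ˡ · T ⊆ f^* T′`, `rk T_X = rk T_{X′}`, and `f^*|_{T′} : T′ ↪ T` has finite index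

Layer `Literature/Geometry/Kaehler`, namespace `Literature.Geometry.Kaehler.ComplexTorus`; lane `lit-hodgefound` (Track 2
foundations library), seat p09, generation 31, row g31-#12. THEOREMS ONLY (0 definitions); no named fact, net debt 0. The all-degrees form
of g31-#7 (`ComplexTorusMiddleTranscendentalLatticeIsogeny`, middle degree `k = l = 2p = g`) for the degree-`l` transcendental lattice of
g31-#11 (`ComplexTorusTranscendentalLatticeAllDegrees`), i.e. the annihilator

  `T = Hˡ(X, ℤ) ∩ ⋂_{s ∈ Hdg^{k,p}(X, ℤ)} ker ⟨s, ·⟩ = integralForms Φ l ⊓ ⨅ s, (ker (poincarePairing Φ e h s)).toAddSubgroup`   (`k + l = |ι|`)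

of the integral Hodge classes under the cup-product pairing (written out exactly as there; no definition), along an isogeny `f = ρ(A) :
X → X′` (`IsIsogeny Φ Φ′ A`, exponent `e(f)`, quasi-inverse `g` with `gf = e_X`, Lange Prop. 1.1.15):

* §1 **`⟨ρ(A)^*x, ρ(A)^*y⟩_e = det(A_{ẽ′ẽ}) · ⟨x, y⟩_{e′}`** for EVERY integer matrix `A` and all `x ∈ Hᵏ(X′)`, `y ∈ Hˡ(X′)` (Lange §1.7.2
  Cor. 1.7.6 proof: "`∫_Y f^*ω = (Λ : ρ_r(f)(Λ′)) ∫_X ω`", the tree's `torusIntegral_comp_realRep_eq_sign_mul`; g31-#7 is the case `k = l`).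
* §2 **`f^* T′ ⊆ T`** (for `s ∈ Hdg^{k,p}(X, ℤ)`, `e^k s = f^*s′` with `s′ ∈ Hdg^{k,p}(X′, ℤ)` by g31-#6, so `e^k ⟨s, f^*t⟩ = det · ⟨s′, t⟩ = 0`),
  **`e(f)ˡ · T ⊆ f^* T′`** (`t′ = g^*t`).
* §3 **`rk_ℤ T_X = rk_ℤ T_{X′}`** (injections both ways) — also for `IsIsogenous` —, and **`f^*|_{T′} : T′ → T` injective with
  `Finite (T ⧸ f^*T′)`** (Mathlib's `Submodule.finiteQuotientOfFreeOfRankEq`).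

## References

* [cite: Lange2023AbelianVarietiesComplex, §1.7.2 Cor. 1.7.6 (proof); §1.1.2 Prop. 1.1.15 (PDF p. 22); §6.2.4 (p. 310); §7.2.2]
* [cite: ShiodaMitani1974, §1 (1.5) and §3 (3.19)]
* [cite: Huybrechts2016K3, Ch. 3 §2.2–2.3 (PDF pp. 58–59); Ch. 14 §0.1 (PDF p. 333)]
-/

noncomputable section

open Module Function

namespace Literature.Geometry.Kaehler.ComplexTorus

section AllDegreesIsogeny

variable {ι ι' : Type*} [Fintype ι] [Fintype ι'] [DecidableEq ι] [DecidableEq ι']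
  {E E' : Type*} [NormedAddCommGroup E] [NormedSpace ℂ E] [NormedAddCommGroup E'] [NormedSpace ℂ E']
  (Φ : (ι → ℝ) ≃L[ℝ] E) (Φ' : (ι' → ℝ) ≃L[ℝ] E') {n k l : ℕ} (e : Fin n ≃ ι) (e' : Fin n ≃ ι') (h : k + l = n) (p : ℕ)

/-! ## §1 `⟨f^*x, f^*y⟩_X = det ρ_r(f) · ⟨x, y⟩_{X′}` in every bidegree -/

/-- **`⟨ρ(A)^*x, ρ(A)^*y⟩_e = det(A_{ẽ′ẽ}) · ⟨x, y⟩_{e′}`** for every integer matrix `A : ι′ × ι`, `x ∈ Hᵏ(X′, ℂ)`, `y ∈ Hˡ(X′, ℂ)`,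
`k + l = |ι| = |ι′|` (`ẽ = (finCongr h).trans e`; `⟨x, y⟩_e = sign(ẽ) ∫_X x ∧ y` and `∫_X ρ(A)^*θ = sign(ẽ) sign(ẽ′) det(A_{ẽ′ẽ}) ∫_{X′} θ`).
The case `k = l` is g31-#7's `poincarePairing_comp_realRep_eq_det_mul`. [cite: Lange2023AbelianVarietiesComplex, §1.7.2 Cor. 1.7.6 (proof) and §6.2.4 (p. 310)] [cite: ShiodaMitani1974, §1 (1.5)] -/
theorem poincarePairing_comp_realRep_comp_realRep (A : Matrix ι' ι ℤ) (x : E' [⋀^Fin k]→L[ℝ] ℂ) (y : E' [⋀^Fin l]→L[ℝ] ℂ) :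
    poincarePairing Φ e h (x.compContinuousLinearMap (realRep Φ Φ' A)) (y.compContinuousLinearMap (realRep Φ Φ' A)) =
      ((A.submatrix ((finCongr h).trans e') ((finCongr h).trans e)).det : ℂ) * poincarePairing Φ' e' h x y := by
  rw [poincarePairing_eq_orientationSign_mul_torusIntegral_wedge,
    poincarePairing_eq_orientationSign_mul_torusIntegral_wedge Φ' e' h, ← ContinuousAlternatingMap.wedge_compContinuousLinearMap,
    torusIntegral_comp_realRep_eq_sign_mul Φ Φ' A ((finCongr h).trans e) ((finCongr h).trans e') (x.wedge y)]
  have hs : (orientationSign Φ ((finCongr h).trans e) : ℂ) * orientationSign Φ ((finCongr h).trans e) = 1 := by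
    exact_mod_cast orientationSign_mul_self Φ ((finCongr h).trans e)
  simp only [Int.cast_mul]
  linear_combination ((orientationSign Φ' ((finCongr h).trans e') : ℂ) *
    ((A.submatrix ((finCongr h).trans e') ((finCongr h).trans e)).det : ℂ) *
      torusIntegral Φ' ((finCongr h).trans e') (x.wedge y)) * hs

/-! ## §2 `f^* T′ ⊆ T` and `e(f)ˡ · T ⊆ f^* T′` -/

/-- **`f^* T′ ⊆ T` in every degree** for an isogeny `f = ρ(A) : X → X′`: for `t ∈ T′ = Hdg^{k,p}(X′, ℤ)^⊥ ∩ Hˡ(X′, ℤ)` and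
`s ∈ Hdg^{k,p}(X, ℤ)`, g31-#6 gives `s′ ∈ Hdg^{k,p}(X′, ℤ)` with `f^*s′ = e^k · s` (`e = e(f)`), so `e^k ⟨s, f^*t⟩ = ⟨f^*s′, f^*t⟩ =
det · ⟨s′, t⟩ = 0`. [cite: Lange2023AbelianVarietiesComplex, §1.1.2 Prop. 1.1.15 (PDF p. 22) and §1.7.2 Cor. 1.7.6 (proof)] [cite: ShiodaMitani1974, §3 (3.19)] -/
theorem IsIsogeny.comp_realRep_mem_integralHodgeAnnihilator {A : Matrix ι' ι ℤ} (hf : IsIsogeny Φ Φ' A)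
    {t : E' [⋀^Fin l]→L[ℝ] ℂ}
    (ht : t ∈ integralForms Φ' l ⊓ ⨅ s : integralHodgeClassesIn Φ' k p,
        (LinearMap.ker (poincarePairing Φ' e' h (s : E' [⋀^Fin k]→L[ℝ] ℂ))).toAddSubgroup) :
    t.compContinuousLinearMap (realRep Φ Φ' A) ∈ integralForms Φ l ⊓ ⨅ s : integralHodgeClassesIn Φ k p,
        (LinearMap.ker (poincarePairing Φ e h (s : E [⋀^Fin k]→L[ℝ] ℂ))).toAddSubgroup := by
  rw [mem_integralHodgeAnnihilator_iff] at ht ⊢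
  refine ⟨comp_realRep_mem_integralForms Φ Φ' A ht.1, fun s hs ↦ ?_⟩
  obtain ⟨s', hs', hs'eq⟩ := hf.exists_comp_realRep_eq_pow_smul_of_mem_integralHodgeClassesIn Φ Φ' (k := k) (p := p) hs
  have h0 := ht.2 s' hs'
  have hN : ((AddMonoid.exponent (mapMatrixHom Φ Φ' A).ker : ℂ) ^ k) ≠ 0 :=
    pow_ne_zero _ (Nat.cast_ne_zero.2 hf.exponent_ker_pos.ne')
  have key : ((AddMonoid.exponent (mapMatrixHom Φ Φ' A).ker : ℂ) ^ k) *
      poincarePairing Φ e h s (t.compContinuousLinearMap (realRep Φ Φ' A)) = 0 := by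
    rw [← smul_eq_mul, ← LinearMap.smul_apply, ← map_smul, ← hs'eq, poincarePairing_comp_realRep_comp_realRep Φ Φ' e e' h A,
      h0, mul_zero]
  exact (mul_eq_zero.1 key).resolve_left hN

/-- **`e(f)ˡ · T ⊆ f^* T′` in every degree**: every `t ∈ T_X` has `e^l · t = f^*t′` with `t′ = g^*t ∈ T_{X′}` for the quasi-inverse
isogeny `g` (`gf = e_X`, Prop. 1.1.15; `[e]^* = eˡ` on `Hˡ`). [cite: Lange2023AbelianVarietiesComplex, §1.1.2 Prop. 1.1.15 (PDF p. 22) and §1.1.3 Exercise 1.1.6 (7)] -/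
theorem IsIsogeny.exists_comp_realRep_eq_pow_smul_of_mem_integralHodgeAnnihilator {A : Matrix ι' ι ℤ} (hf : IsIsogeny Φ Φ' A)
    {t : E [⋀^Fin l]→L[ℝ] ℂ}
    (ht : t ∈ integralForms Φ l ⊓ ⨅ s : integralHodgeClassesIn Φ k p,
        (LinearMap.ker (poincarePairing Φ e h (s : E [⋀^Fin k]→L[ℝ] ℂ))).toAddSubgroup) :
    ∃ t' ∈ integralForms Φ' l ⊓ ⨅ s : integralHodgeClassesIn Φ' k p,
        (LinearMap.ker (poincarePairing Φ' e' h (s : E' [⋀^Fin k]→L[ℝ] ℂ))).toAddSubgroup,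
      t'.compContinuousLinearMap (realRep Φ Φ' A) = ((AddMonoid.exponent (mapMatrixHom Φ Φ' A).ker : ℂ) ^ l) • t := by
  obtain ⟨Bq, hBq, hBqA, -⟩ := hf.exists_quasiInverse
  refine ⟨t.compContinuousLinearMap (realRep Φ' Φ Bq), hBq.comp_realRep_mem_integralHodgeAnnihilator Φ' Φ e' e h p ht, ?_⟩
  have hc : (t.compContinuousLinearMap (realRep Φ' Φ Bq)).compContinuousLinearMap (realRep Φ Φ' A) =
      t.compContinuousLinearMap ((realRep Φ' Φ Bq).comp (realRep Φ Φ' A)) := by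
    ext v; rfl
  rw [hc, realRep_mul, hBqA, comp_realRep_smul_one, Int.cast_natCast]

/-! ## §3 `rk T_X = rk T_{X′}`; `f^*|_{T′}` is injective with finite cokernel -/

omit [Fintype ι'] [DecidableEq ι'] in
/-- The degree-`l` transcendental lattice is a finitely generated free abelian group (a subgroup of the lattice `Hˡ(X, ℤ)`).
[cite: Lange2023AbelianVarietiesComplex, §1.1.3 Exercise 1.1.6 (8)] -/
theorem moduleFinite_integralHodgeAnnihilator :
    Module.Finite ℤ ↥(integralForms Φ l ⊓ ⨅ s : integralHodgeClassesIn Φ k p,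
        (LinearMap.ker (poincarePairing Φ e h (s : E [⋀^Fin k]→L[ℝ] ℂ))).toAddSubgroup) := by
  haveI : Module.Finite ℤ (integralForms Φ l) := finite_integralForms Φ l
  have hle : integralForms Φ l ⊓ ⨅ s : integralHodgeClassesIn Φ k p,
      (LinearMap.ker (poincarePairing Φ e h (s : E [⋀^Fin k]→L[ℝ] ℂ))).toAddSubgroup ≤ integralForms Φ l := inf_le_left
  exact Module.Finite.of_injective (AddSubgroup.inclusion hle).toIntLinearMap (AddSubgroup.inclusion_injective hle)

omit [Fintype ι'] [DecidableEq ι'] in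
/-- … and torsion free, hence free. [cite: Lange2023AbelianVarietiesComplex, §1.1.3 Exercise 1.1.6 (8)] -/
theorem moduleFree_integralHodgeAnnihilator :
    Module.Free ℤ ↥(integralForms Φ l ⊓ ⨅ s : integralHodgeClassesIn Φ k p,
        (LinearMap.ker (poincarePairing Φ e h (s : E [⋀^Fin k]→L[ℝ] ℂ))).toAddSubgroup) := by
  haveI : Module.Free ℤ (integralForms Φ l) := free_integralForms Φ l
  haveI := moduleFinite_integralHodgeAnnihilator Φ e h p (k := k) (l := l)
  have hle : integralForms Φ l ⊓ ⨅ s : integralHodgeClassesIn Φ k p,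
      (LinearMap.ker (poincarePairing Φ e h (s : E [⋀^Fin k]→L[ℝ] ℂ))).toAddSubgroup ≤ integralForms Φ l := inf_le_left
  let j := (AddSubgroup.inclusion hle).toIntLinearMap
  haveI : Module.IsTorsionFree ℤ ↥(integralForms Φ l ⊓ ⨅ s : integralHodgeClassesIn Φ k p,
      (LinearMap.ker (poincarePairing Φ e h (s : E [⋀^Fin k]→L[ℝ] ℂ))).toAddSubgroup) :=
    Function.Injective.moduleIsTorsionFree j (AddSubgroup.inclusion_injective hle) (map_smul j)
  infer_instance

/-- **`f^*|_{T′} : T_{X′} → T_X` as an injective `ℤ`-linear map, in every degree** (injective on all of `Hˡ` for an isogeny, the tree's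
`comp_realRep_injective_of_isogeny`). [cite: Lange2023AbelianVarietiesComplex, §1.1.2 Prop. 1.1.15 (PDF p. 22) and §7.3.3 Exercise (1)(a)] -/
theorem IsIsogeny.exists_intLinearMap_integralHodgeAnnihilator_injective {A : Matrix ι' ι ℤ} (hf : IsIsogeny Φ Φ' A) :
    ∃ R : ↥(integralForms Φ' l ⊓ ⨅ s : integralHodgeClassesIn Φ' k p,
          (LinearMap.ker (poincarePairing Φ' e' h (s : E' [⋀^Fin k]→L[ℝ] ℂ))).toAddSubgroup) →ₗ[ℤ]
        ↥(integralForms Φ l ⊓ ⨅ s : integralHodgeClassesIn Φ k p,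
          (LinearMap.ker (poincarePairing Φ e h (s : E [⋀^Fin k]→L[ℝ] ℂ))).toAddSubgroup),
      (∀ t, (R t : E [⋀^Fin l]→L[ℝ] ℂ) = (t : E' [⋀^Fin l]→L[ℝ] ℂ).compContinuousLinearMap (realRep Φ Φ' A)) ∧ Injective R := by
  obtain ⟨Bq, -, -, hABq⟩ := hf.exists_quasiInverse
  have hN : (AddMonoid.exponent (mapMatrixHom Φ Φ' A).ker : ℤ) ≠ 0 := Int.natCast_ne_zero.2 hf.exponent_ker_pos.ne'
  refine ⟨(AddMonoidHom.mk' (fun t ↦ ⟨(t : E' [⋀^Fin l]→L[ℝ] ℂ).compContinuousLinearMap (realRep Φ Φ' A),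
      hf.comp_realRep_mem_integralHodgeAnnihilator Φ Φ' e e' h p t.2⟩) fun _ _ ↦ Subtype.ext (by ext v; rfl)).toIntLinearMap,
    fun _ ↦ rfl, fun t t' htt ↦ Subtype.ext (comp_realRep_injective_of_isogeny Φ Φ' A Bq hN hABq ?_)⟩
  exact congrArg (fun z : ↥(integralForms Φ l ⊓ ⨅ s : integralHodgeClassesIn Φ k p,
    (LinearMap.ker (poincarePairing Φ e h (s : E [⋀^Fin k]→L[ℝ] ℂ))).toAddSubgroup) ↦ (z : E [⋀^Fin l]→L[ℝ] ℂ)) htt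

/-- **`rk_ℤ T_X = rk_ℤ T_{X′}` in every degree along an isogeny** (`f^*` and `g^*` inject `T′ ↪ T ↪ T′`).
[cite: ShiodaMitani1974, §3 (3.19)] [cite: Lange2023AbelianVarietiesComplex, §1.1.2 Prop. 1.1.15 (PDF p. 22) and §7.3.3 Exercise (1)(a)] -/
theorem IsIsogeny.finrank_integralHodgeAnnihilator_eq {A : Matrix ι' ι ℤ} (hf : IsIsogeny Φ Φ' A) :
    finrank ℤ ↥(integralForms Φ l ⊓ ⨅ s : integralHodgeClassesIn Φ k p,
        (LinearMap.ker (poincarePairing Φ e h (s : E [⋀^Fin k]→L[ℝ] ℂ))).toAddSubgroup) =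
      finrank ℤ ↥(integralForms Φ' l ⊓ ⨅ s : integralHodgeClassesIn Φ' k p,
        (LinearMap.ker (poincarePairing Φ' e' h (s : E' [⋀^Fin k]→L[ℝ] ℂ))).toAddSubgroup) := by
  obtain ⟨Bq, hBq, -, -⟩ := hf.exists_quasiInverse
  obtain ⟨R, -, hR⟩ := hf.exists_intLinearMap_integralHodgeAnnihilator_injective Φ Φ' e e' h p (k := k) (l := l)
  obtain ⟨R', -, hR'⟩ := hBq.exists_intLinearMap_integralHodgeAnnihilator_injective Φ' Φ e' e h p (k := k) (l := l)
  haveI := moduleFinite_integralHodgeAnnihilator Φ e h p (k := k) (l := l)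
  haveI := moduleFinite_integralHodgeAnnihilator Φ' e' h p (k := k) (l := l)
  exact le_antisymm (LinearMap.finrank_le_finrank_of_injective hR') (LinearMap.finrank_le_finrank_of_injective hR)

/-- **`rk_ℤ T_X = rk_ℤ T_{X′}` in every degree for isogenous complex tori.** [cite: ShiodaMitani1974, §3 (3.19)] [cite: Lange2023AbelianVarietiesComplex, §7.3.3 Exercise (1)(a)] -/
theorem IsIsogenous.finrank_integralHodgeAnnihilator_eq (hiso : IsIsogenous Φ Φ') :
    finrank ℤ ↥(integralForms Φ l ⊓ ⨅ s : integralHodgeClassesIn Φ k p,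
        (LinearMap.ker (poincarePairing Φ e h (s : E [⋀^Fin k]→L[ℝ] ℂ))).toAddSubgroup) =
      finrank ℤ ↥(integralForms Φ' l ⊓ ⨅ s : integralHodgeClassesIn Φ' k p,
        (LinearMap.ker (poincarePairing Φ' e' h (s : E' [⋀^Fin k]→L[ℝ] ℂ))).toAddSubgroup) := by
  obtain ⟨A, hA⟩ := hiso
  exact hA.finrank_integralHodgeAnnihilator_eq Φ Φ' e e' h p

/-- **`f^*|_{T′} : T_{X′} ↪ T_X` has finite cokernel in every degree** (equal ranks, `Submodule.finiteQuotientOfFreeOfRankEq`; an explicit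
exponent is `e(f)ˡ`, `IsIsogeny.exists_comp_realRep_eq_pow_smul_of_mem_integralHodgeAnnihilator`).
[cite: Lange2023AbelianVarietiesComplex, §1.1.2 Prop. 1.1.15 (PDF p. 22)] [cite: Huybrechts2016K3, Ch. 14 §0.1 (PDF p. 333)] -/
theorem IsIsogeny.exists_intLinearMap_integralHodgeAnnihilator_injective_finite {A : Matrix ι' ι ℤ} (hf : IsIsogeny Φ Φ' A) :
    ∃ R : ↥(integralForms Φ' l ⊓ ⨅ s : integralHodgeClassesIn Φ' k p,
          (LinearMap.ker (poincarePairing Φ' e' h (s : E' [⋀^Fin k]→L[ℝ] ℂ))).toAddSubgroup) →ₗ[ℤ]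
        ↥(integralForms Φ l ⊓ ⨅ s : integralHodgeClassesIn Φ k p,
          (LinearMap.ker (poincarePairing Φ e h (s : E [⋀^Fin k]→L[ℝ] ℂ))).toAddSubgroup),
      (∀ t, (R t : E [⋀^Fin l]→L[ℝ] ℂ) = (t : E' [⋀^Fin l]→L[ℝ] ℂ).compContinuousLinearMap (realRep Φ Φ' A)) ∧ Injective R ∧
        Finite (↥(integralForms Φ l ⊓ ⨅ s : integralHodgeClassesIn Φ k p,
          (LinearMap.ker (poincarePairing Φ e h (s : E [⋀^Fin k]→L[ℝ] ℂ))).toAddSubgroup) ⧸ LinearMap.range R) := by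
  obtain ⟨R, hR, hinj⟩ := hf.exists_intLinearMap_integralHodgeAnnihilator_injective Φ Φ' e e' h p (k := k) (l := l)
  haveI := moduleFinite_integralHodgeAnnihilator Φ e h p (k := k) (l := l)
  haveI := moduleFree_integralHodgeAnnihilator Φ e h p (k := k) (l := l)
  have hrk : finrank ℤ (LinearMap.range R) = finrank ℤ ↥(integralForms Φ l ⊓ ⨅ s : integralHodgeClassesIn Φ k p,
      (LinearMap.ker (poincarePairing Φ e h (s : E [⋀^Fin k]→L[ℝ] ℂ))).toAddSubgroup) := by
    rw [← (LinearEquiv.ofInjective R hinj).finrank_eq, hf.finrank_integralHodgeAnnihilator_eq Φ Φ' e e' h p]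
  exact ⟨R, hR, hinj, Submodule.finiteQuotientOfFreeOfRankEq _ hrk⟩

end AllDegreesIsogeny

end Literature.Geometry.Kaehler.ComplexTorus
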